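import Mathlib
import Summits.ABC.IUTFork.Joshi.LocalPeriodRingsModelTower
import HarnessLib

/-!
# (5.2.6.1) `B_e = B⁺[1/t]^{φ=1} = B[1/t]^{φ=1} = B_cris^{φ=1}` TESTED at the §5 tower model: the first description
# HOLDS at the model of record, the third FAILS there and HOLDS on a second tower over the same datum (proof-only, 0 defs)

Test-side support file of the abc-iut cell, branch E (rung LADDER-ABC:A2.E; seat abc-iut-E-t9 gen 4, authors-first
companion per E-plan-2 RE-SEAT POLICY 2026-08-26T09:48:21Z (2) / RULINGS 12:10Z (5)). Source numbering: K. Joshi,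
*Construction of Arithmetic Teichmüller Spaces III*, arXiv:2401.13508v4 (bib `Joshi2024ATS3`, unrefereed), §5.2.6 p. 40
l. 17–34 of the cell's render `HOME/lit/renders/Joshi-arxiv-2401.13508/p0040.txt`: «(5.2.6.1)
`B_e = B⁺[1/t]^{φ=1} = B[1/t]^{φ=1} = B_cris^{φ=1}` … [FF18, Thm. 6.5.2]».

WHAT IS TESTED. Slot T-09's signature file `Joshi/LocalPeriodRings.lean` (p429989) DEFINES `B_e` by the middle description
(`PeriodRingTower.Be`, spelled with `φ` on `B` only) and carries the two other descriptions as claim-tagged `Prop`s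
`PeriodRingTower.BeEqBplusLoc` (first) and `PeriodRingTower.BeEqBcrisPhiOne` (third), cited [FF18, Thm. 6.5.2], never
asserted — the last two T-09 claim-`Prop`s without a kernel test at any model (this lineage's close 2026-08-26T13:27:45Z).
Over the tower model of record `Model.towerModel p` (p438686: `B = A[S]`, `A = Q̄_p[ℚ]`, `B_dR = K′((S))` with
`K′ = Frac A`, `t = S`, `φ = (S ↦ p·S)`, `B⁺_cris := B⁺_dR = K′⟦S⟧`, `B_cris := B⁺_dR[1/t]`) this file PROVES:
* §1 `towerModel_mem_Be_iff` — `B_e` COMPUTED: the `φ`-eigenvectors of eigenvalue `pⁿ` in `A[S]` are the monomials `a·Sⁿ`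
  (`eq_C_mul_X_pow_of_frobEquivA_eq`), so `B_e = B[1/t]^{φ=1}` is the ring of constants `A ⊂ K′ ⊂ K′((S))`;
* §2 `towerModel_beEqBplusLoc` — the FIRST description HOLDS: `B_e = B⁺[1/t]^{φ=1}` (witness `(n+1, b·t)`: `b·S ∈ B⁺` because
  its constant coefficient vanishes — the semi-norm feature `|t|_ρ = 0` of the logical model, p438686 `model_norm_t_eq_zero`);
* §3 `towerModel_not_beEqBcrisPhiOne` — the THIRD description FAILS: `B_cris^{φ=1} ⊇ K′ ⊋ A = B_e`, witness the constant
  `(1 − T)⁻¹ ∈ K′` (`1 − T` is a nonzero non-unit of `A`: the augmentation `T^q ↦ 1` kills it, `η₁ : T^q ↦ Χ(q)` does not);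
  the inclusion `B_e ⊆ B_cris^{φ=1}` does hold there (`towerModel_Be_subset`);
* §4 `exists_tower_beEqBplusLoc_and_beEqBcrisPhiOne` — on a SECOND tower over the SAME datum `towerDatum p`, the same
  `B ↪ B_dR`, `t`, `B⁺_dR`, Frobenius and Galois data, differing from the model of record ONLY in the datum
  `(B⁺_cris, B_cris, φ_cris) := (B, B[1/t], φ|)` (which the typed signature leaves free: it asks `B⁺ ↪ B⁺_cris`,
  `B_cris = B⁺_cris[1/t]`, `φ_cris` extending `φ` on `B⁺`), BOTH descriptions hold (normal form `toBdR f · S⁻ᵐ` in `B[1/t]`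
  and `φ(toBdR f · S⁻ᵐ) = toBdR f · S⁻ᵐ ⟺ φ(f) = pᵐ f`); packaged as an `∃`, no `def`.
UPSHOT (registry wording for node J3:§5.2.6 / (5.2.6.1)): `BeEqBplusLoc` and `BeEqBcrisPhiOne` are JOINTLY SATISFIABLE with
every typed §5 tower axiom and E-t3's §2 signature (`beEqBcrisPhiOne_independent`, second conjunct), and `BeEqBcrisPhiOne`
is INDEPENDENT of them (false at the model of record, first conjunct): it is a constraint on the `B_cris` datum, to be
taken BY NAME as the cited [FF18] input by any consumer — consistent, not derivable. HONEST SCOPE: a LOGICAL model (as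
p436997/p438686/p442460); nothing is claimed about [FF18]'s rings `B`, `B_cris`, about [FF18, Thm. 6.5.2], or about any
author's mathematics. TAKES NO SIDE on [IUTchIII] Cor. 3.12; typed ≠ proved ≠ endorsed; NO abc claim. DEFS-FREEZE respected
(p429989 / p436997 / p438686 imported BY NAME); 0 `def`, no `Prop` definition, no instance, no notation, 0 `sorry`. [folklore]
bears_on: LADDER-ABC:A2.E
-/

noncomputable section

open Polynomial

namespace Summit.ABC.IUTFork.Joshi.Model

variable (p : ℕ) [hp : Fact p.Prime]

/-! ## 1. `φ`-eigenvectors in `B = A[S]`; `B_e` at the model of record -/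

/-- `φ(f) = f(p·S)` coefficientwise: the `i`-th coefficient is multiplied by `pⁱ`. [folklore] -/
theorem coeff_frobEquivA (f : TowerRing p) (i : ℕ) : (frobEquivA p f).coeff i = (p : ExpAlg p) ^ i * f.coeff i := by
  refine Polynomial.induction_on' f (fun f g hf hg => ?_) (fun n a => ?_)
  · rw [map_add, coeff_add, coeff_add, hf, hg, mul_add]
  · rw [frobEquivA_apply, aeval_monomial, Polynomial.algebraMap_eq, mul_pow,
      ← map_natCast (C : ExpAlg p →+* TowerRing p), ← map_pow, ← mul_assoc, ← map_mul, coeff_C_mul_X_pow,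
      coeff_monomial]
    by_cases h : i = n
    · subst h; simp [mul_comm]
    · simp [h, Ne.symm h]

/-- `pⁱ = pⁿ` in `A = Q̄_p[ℚ]` forces `i = n` (apply the augmentation `T^q ↦ 1` and read in `Q̄_p ⊃ ℚ`). [folklore] -/
theorem natCast_pow_injective_expAlg {i n : ℕ} (h : (p : ExpAlg p) ^ i = (p : ExpAlg p) ^ n) : i = n := by
  haveI : CharZero (PadicAlgCl p) :=
    charZero_of_injective_algebraMap (algebraMap ℚ_[p] (PadicAlgCl p)).injective
  have h' := congrArg (AddMonoidAlgebra.lift (PadicAlgCl p) (PadicAlgCl p) ℚ (1 : Multiplicative ℚ →* PadicAlgCl p)) h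
  rw [map_pow, map_pow, map_natCast, ← Nat.cast_pow, ← Nat.cast_pow, Nat.cast_inj] at h'
  exact Nat.pow_right_injective hp.out.two_le h'

/-- **The `φ`-eigenvectors of eigenvalue `pⁿ` in `B = A[S]` are the monomials `a·Sⁿ`.** [folklore] -/
theorem eq_C_mul_X_pow_of_frobEquivA_eq {n : ℕ} {b : TowerRing p} (h : frobEquivA p b = (p : TowerRing p) ^ n * b) :
    b = C (b.coeff n) * X ^ n := by
  refine Polynomial.ext fun i => ?_
  rw [coeff_C_mul_X_pow]
  split_ifs with hi
  · rw [hi]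
  · have h1 := congrArg (fun f : TowerRing p => f.coeff i) h
    simp only [coeff_frobEquivA] at h1
    rw [← map_natCast (C : ExpAlg p →+* TowerRing p), ← map_pow, coeff_C_mul] at h1
    have h2 : ((p : ExpAlg p) ^ i - (p : ExpAlg p) ^ n) * b.coeff i = 0 := by rw [sub_mul, h1, sub_self]
    exact (mul_eq_zero.1 h2).resolve_left (sub_ne_zero.2 fun h3 => hi (natCast_pow_injective_expAlg p h3))

/-- Unfolding `B_e` ((5.2.6.1), middle description, p429989 `PeriodRingTower.Be`) at the model tower. [folklore] -/
theorem towerModel_mem_Be_iff' (x : Omega p) : x ∈ (towerModel p).Be ↔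
    ∃ (n : ℕ) (b : TowerRing p), toBdRAlg p b = toBdRAlg p X ^ n * x ∧ frobEquivA p b = (p : TowerRing p) ^ n * b :=
  Iff.rfl

/-- `toBdR(S) ≠ 0` in `B_dR`. [folklore] -/
theorem toBdRAlg_X_ne_zero : toBdRAlg p X ≠ 0 := (towerModel p).toBdR_t_ne_zero

/-- **`B_e` AT THE MODEL OF RECORD is the ring of constants `A = Q̄_p[ℚ] ⊂ K′ ⊂ K′((S))`.** [folklore] -/
theorem towerModel_mem_Be_iff (x : Omega p) : x ∈ (towerModel p).Be ↔ ∃ a : ExpAlg p, x = toBdRAlg p (C a) := by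
  rw [towerModel_mem_Be_iff']
  constructor
  · rintro ⟨n, b, hb, hφ⟩
    refine ⟨b.coeff n, ?_⟩
    rw [eq_C_mul_X_pow_of_frobEquivA_eq p hφ, map_mul, map_pow, mul_comm] at hb
    exact (mul_left_cancel₀ (pow_ne_zero n (toBdRAlg_X_ne_zero p)) hb).symm
  · rintro ⟨a, rfl⟩
    exact ⟨0, C a, by rw [pow_zero, one_mul],
      by rw [pow_zero, one_mul, frobEquivA_apply, aeval_C, Polynomial.algebraMap_eq]⟩

/-! ## 2. The first description `B_e = B⁺[1/t]^{φ=1}` HOLDS at the model of record -/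

/-- `b·S ∈ B⁺` for every `b ∈ B`: the constant coefficient vanishes (`|S|_ρ = 0`, p438686 `model_norm_t_eq_zero`). [folklore] -/
theorem mul_X_mem_Bplus (b : TowerRing p) : b * X ∈ (towerDatum p).Bplus := by
  rw [mem_Bplus_iff, mul_coeff_zero, coeff_X_zero, mul_zero, ordNorm_zero]; exact zero_le_one

/-- **(5.2.6.1), FIRST DESCRIPTION, HOLDS AT THE MODEL OF RECORD**: `B[1/t]^{φ=1} = B⁺[1/t]^{φ=1}`, i.e. T-09's claim-`Prop`
`PeriodRingTower.BeEqBplusLoc` is TRUE for `Model.towerModel p` (witness: replace `(n, b)` by `(n+1, b·t)`). [folklore] -/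
theorem towerModel_beEqBplusLoc : (towerModel p).BeEqBplusLoc := by
  show (towerModel p).Be = _
  refine Set.Subset.antisymm ?_ ?_
  · rintro x ⟨n, b, hb, hφ⟩
    have hb' : toBdRAlg p b = toBdRAlg p X ^ n * x := hb
    have hφ' : frobEquivA p b = (p : TowerRing p) ^ n * b := hφ
    refine ⟨n + 1, b * X, mul_X_mem_Bplus p b, ?_, ?_⟩
    · show toBdRAlg p (b * X) = toBdRAlg p X ^ (n + 1) * x
      rw [map_mul, hb', pow_succ]; ring
    · show frobEquivA p (b * X) = (p : TowerRing p) ^ (n + 1) * (b * X)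
      rw [map_mul, hφ', frobEquivA_X, pow_succ]; ring
  · rintro x ⟨n, b, -, hb, hφ⟩
    exact ⟨n, b, hb, hφ⟩

/-! ## 3. The third description `B_e = B_cris^{φ=1}` FAILS at the model of record -/

/-- `1 − T` is NOT a unit of `A = Q̄_p[ℚ]`: the augmentation `ε : T^q ↦ 1` kills it. [folklore] -/
theorem one_sub_T_mul_ne_one (a : ExpAlg p) : (1 - AddMonoidAlgebra.single 1 1 : ExpAlg p) * a ≠ 1 := by
  intro h
  have h' := congrArg
    (AddMonoidAlgebra.lift (PadicAlgCl p) (PadicAlgCl p) ℚ (1 : Multiplicative ℚ →* PadicAlgCl p)) h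
  rw [map_mul, map_sub, map_one, AddMonoidAlgebra.lift_single, MonoidHom.one_apply, one_smul, sub_self,
    zero_mul] at h'
  exact zero_ne_one h'

/-- `‖p‖ = p⁻¹` in `Q̄_p` (local copy of p436997's private lemma). [folklore] -/
theorem norm_natCast_p : ‖(p : PadicAlgCl p)‖ = (p : ℝ)⁻¹ := by
  rw [← map_natCast (algebraMap ℚ_[p] (PadicAlgCl p)), ← PadicAlgCl.coe_eq]
  show ‖((p : ℚ_[p]) : PadicAlgCl p)‖ = _
  rw [PadicAlgCl.norm_extends, Padic.norm_p]

/-- `1 − T ≠ 0` in `A`: the residue map `η₁ : T^q ↦ Χ(q)` of p436997 sends it to `1 − p ≠ 0`. [folklore] -/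
theorem one_sub_T_ne_zero : (1 - AddMonoidAlgebra.single 1 1 : ExpAlg p) ≠ 0 := by
  intro h
  have h' := congrArg (etaA p 1) h
  rw [map_sub, map_one, map_zero, etaA_single, one_mul, (by simp [eRat] : eRat (1 : ℚ) = 1), div_one, chi_one,
    sub_eq_zero] at h'
  have h1 : (1 : ℝ) < p := by exact_mod_cast hp.out.one_lt
  have h2 : ‖(p : PadicAlgCl p)‖ = 1 := by rw [← h', norm_one]
  rw [norm_natCast_p] at h2
  exact (inv_lt_one_of_one_lt₀ h1).ne h2

/-- At the model of record `B_e ⊆ B_cris^{φ=1}` (the constants `A` lie in `B⁺_dR = B⁺_cris` and are `φ`-fixed) — the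
inclusion that survives. [folklore] -/
theorem towerModel_Be_subset :
    (towerModel p).Be ⊆ {x | ∃ hx : x ∈ (towerModel p).Bcris, (((towerModel p).frobCris ⟨x, hx⟩ : (towerModel p).Bcris) :
      Omega p) = x} := by
  intro x hx
  obtain ⟨a, rfl⟩ := (towerModel_mem_Be_iff p x).1 hx
  have hmem : toBdRAlg p (C a) ∈ (towerModel p).Bcris := by
    change toBdRAlg p (C a) ∈ Bcris p
    rw [Bcris]
    exact Algebra.subset_adjoin (Set.mem_union_left _ (toBdRAlg_mem_BdRplusΩ p (C a)))
  refine ⟨hmem, ?_⟩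
  show frobΩ p (toBdRAlg p (C a)) = toBdRAlg p (C a)
  rw [frobΩ_toBdR, frobEquivA_apply, aeval_C, Polynomial.algebraMap_eq]

/-- **(5.2.6.1), THIRD DESCRIPTION, FAILS AT THE MODEL OF RECORD**: with `B_cris := B⁺_dR[1/t]` the fixed ring
`B_cris^{φ=1}` contains the constant `(1 − T)⁻¹ ∈ K′ = Frac A`, which is not in `B_e = A`; so T-09's claim-`Prop`
`PeriodRingTower.BeEqBcrisPhiOne` is FALSE for `Model.towerModel p`. [folklore] -/
theorem towerModel_not_beEqBcrisPhiOne : ¬ (towerModel p).BeEqBcrisPhiOne := by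
  intro h
  unfold ATS3.PeriodRingTower.BeEqBcrisPhiOne at h
  set a₀ : ExpAlg p := 1 - AddMonoidAlgebra.single 1 1 with ha₀
  set c : CoefField p := algebraMap (ExpAlg p) (CoefField p) a₀ with hc
  have hc0 : c ≠ 0 := fun h0 =>
    one_sub_T_ne_zero p (IsFractionRing.injective (ExpAlg p) (CoefField p) (by rw [map_zero]; exact h0))
  set x₀ : Omega p := HahnSeries.ofPowerSeries ℤ (CoefField p) (PowerSeries.C c⁻¹) with hx₀
  have hCa₀ : toBdRAlg p (C a₀) = HahnSeries.ofPowerSeries ℤ (CoefField p) (PowerSeries.C c) := by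
    rw [toBdRAlg_apply, toBdRRingHom_C]
  have hmul : toBdRAlg p (C a₀) * x₀ = 1 := by
    rw [hCa₀, hx₀, ← map_mul, ← map_mul, mul_inv_cancel₀ hc0, map_one, map_one]
  -- `x₀ ∈ B_cris`, fixed by `φ_cris`
  have hmem : x₀ ∈ (towerModel p).Bcris := by
    change x₀ ∈ Bcris p
    rw [Bcris]
    exact Algebra.subset_adjoin (Set.mem_union_left _ ⟨PowerSeries.C c⁻¹, rfl⟩)
  have hfix : (((towerModel p).frobCris ⟨x₀, hmem⟩ : (towerModel p).Bcris) : Omega p) = x₀ := by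
    show frobΩ p x₀ = x₀
    rw [hx₀, frobΩ_apply, frobΩRingHom_ofPowerSeries, rescaleP_C]
  have hBe : x₀ ∈ (towerModel p).Be := by rw [h]; exact ⟨hmem, hfix⟩
  -- hence `x₀` is a constant from `A`, and `(1 − T) · a = 1` in `A`
  obtain ⟨a, ha⟩ := (towerModel_mem_Be_iff p x₀).1 hBe
  have h1 : toBdRAlg p (C (a₀ * a)) = toBdRAlg p 1 := by rw [map_mul, map_mul, ← ha, hmul, map_one]
  have h2 : a₀ * a = 1 := C_inj.1 (by rw [C_1]; exact toBdRAlg_injective p h1)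
  exact one_sub_T_mul_ne_one p a h2

/-! ## 4. A second tower over the same datum on which BOTH descriptions hold -/

/-- Unfolding `B[1/t]` (p429989 `PeriodRingTower.Bt`) at the model. [folklore] -/
theorem towerModel_Bt :
    (towerModel p).Bt = Algebra.adjoin ℚ_[p] (((toBdRAlg p).range : Set (Omega p)) ∪ {(toBdRAlg p X)⁻¹}) := rfl

/-- `toBdR f · S⁻ᵐ ∈ B[1/t]`. [folklore] -/
theorem toBdR_mul_inv_pow_mem_Bt (f : TowerRing p) (m : ℕ) :
    toBdRAlg p f * (toBdRAlg p X)⁻¹ ^ m ∈ (towerModel p).Bt := by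
  rw [towerModel_Bt]
  refine Subalgebra.mul_mem _ ?_ (Subalgebra.pow_mem _ ?_ m)
  · exact Algebra.subset_adjoin (Set.mem_union_left _ ((AlgHom.mem_range _).2 ⟨f, rfl⟩))
  · exact Algebra.subset_adjoin (Set.mem_union_right _ (Set.mem_singleton _))

/-- NORMAL FORM in `B[1/t]`: every element is `toBdR f · S⁻ᵐ` with `f ∈ B`. [folklore] -/
theorem exists_eq_toBdR_mul_inv_pow {x : Omega p} (hx : x ∈ (towerModel p).Bt) :
    ∃ (m : ℕ) (f : TowerRing p), x = toBdRAlg p f * (toBdRAlg p X)⁻¹ ^ m := by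
  have hS := toBdRAlg_X_ne_zero p
  rw [towerModel_Bt] at hx
  induction hx using Algebra.adjoin_induction with
  | mem x hx =>
    rcases hx with hx | hx
    · obtain ⟨f, rfl⟩ := (AlgHom.mem_range _).1 hx
      exact ⟨0, f, by rw [pow_zero, mul_one]⟩
    · rw [Set.mem_singleton_iff] at hx
      subst hx
      exact ⟨1, 1, by rw [map_one, one_mul, pow_one]⟩
  | algebraMap r => exact ⟨0, algebraMap ℚ_[p] (TowerRing p) r, by rw [AlgHom.commutes, pow_zero, mul_one]⟩
  | add x y _ _ hx hy =>
    obtain ⟨m, f, rfl⟩ := hx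
    obtain ⟨k, g, rfl⟩ := hy
    refine ⟨m + k, f * X ^ k + g * X ^ m, ?_⟩
    have h1 : toBdRAlg p X ^ k * (toBdRAlg p X)⁻¹ ^ k = 1 := by rw [← mul_pow, mul_inv_cancel₀ hS, one_pow]
    have h2 : toBdRAlg p X ^ m * (toBdRAlg p X)⁻¹ ^ m = 1 := by rw [← mul_pow, mul_inv_cancel₀ hS, one_pow]
    rw [map_add, map_mul, map_mul, map_pow, map_pow, pow_add]
    linear_combination (-(toBdRAlg p f * (toBdRAlg p X)⁻¹ ^ m)) * h1
      + (-(toBdRAlg p g * (toBdRAlg p X)⁻¹ ^ k)) * h2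
  | mul x y _ _ hx hy =>
    obtain ⟨m, f, rfl⟩ := hx
    obtain ⟨k, g, rfl⟩ := hy
    exact ⟨m + k, f * g, by rw [map_mul, pow_add]; ring⟩

/-- `(p : B_dR)⁻¹ = toBdR (C p⁻¹)` lies in the image of `B`. [folklore] -/
theorem inv_natCast_eq_toBdR : (p : Omega p)⁻¹ = toBdRAlg p (C (pInvA p)) := by
  apply inv_eq_of_mul_eq_one_right
  rw [← map_natCast (toBdRAlg p), ← map_mul, natCast_mul_C_pInvA, map_one]

/-- `φ(S⁻¹) = p⁻¹ · S⁻¹` in `B_dR`. [folklore] -/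
theorem frobΩ_inv_X : frobΩ p (toBdRAlg p X)⁻¹ = (p : Omega p)⁻¹ * (toBdRAlg p X)⁻¹ := by
  rw [map_inv₀, frobΩ_toBdR_X, mul_inv]

/-- `φ` maps `B[1/t]` into itself. [folklore] -/
theorem frobΩ_mem_Bt {x : Omega p} (hx : x ∈ (towerModel p).Bt) : frobΩ p x ∈ (towerModel p).Bt := by
  obtain ⟨m, f, rfl⟩ := exists_eq_toBdR_mul_inv_pow p hx
  rw [map_mul, map_pow, frobΩ_toBdR, frobΩ_inv_X, mul_pow, inv_natCast_eq_toBdR, ← map_pow, ← mul_assoc, ← map_mul]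
  exact toBdR_mul_inv_pow_mem_Bt p _ m

/-- KEY COMPUTATION: `φ(toBdR f · S⁻ᵐ) = toBdR f · S⁻ᵐ` in `B_dR` iff `φ(f) = pᵐ·f` in `B`. [folklore] -/
theorem frobΩ_toBdR_mul_inv_pow_eq_iff (f : TowerRing p) (m : ℕ) :
    frobΩ p (toBdRAlg p f * (toBdRAlg p X)⁻¹ ^ m) = toBdRAlg p f * (toBdRAlg p X)⁻¹ ^ m ↔
      frobEquivA p f = (p : TowerRing p) ^ m * f := by
  have hS := toBdRAlg_X_ne_zero p
  have hp0 := natCast_p_ne_zero_Omega p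
  rw [map_mul, map_pow, frobΩ_toBdR, frobΩ_inv_X, ← (toBdRAlg_injective p).eq_iff, map_mul, map_pow, map_natCast,
    mul_pow, ← mul_assoc]
  constructor
  · intro h
    have h' := mul_right_cancel₀ (pow_ne_zero m (inv_ne_zero hS)) h
    rw [← h', mul_comm, mul_assoc, ← mul_pow, inv_mul_cancel₀ hp0, one_pow, mul_one]
  · intro h
    rw [h, mul_comm ((p : Omega p) ^ m) (toBdRAlg p f), mul_assoc (toBdRAlg p f), ← mul_pow, mul_inv_cancel₀ hp0,
      one_pow, mul_one]

/-- **BOTH DESCRIPTIONS HOLD ON A SECOND TOWER OVER THE SAME DATUM.** Over `towerDatum p`, with the SAME `B ↪ B_dR`, `t = S`,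
`B⁺_dR`, Frobenius of `B` and Galois data as `Model.towerModel p`, the tower with `(B⁺_cris, B_cris, φ_cris) := (B, B[1/t], φ|)`
satisfies T-09's `BeEqBplusLoc` AND `BeEqBcrisPhiOne`. (Every field of `ATS3.PeriodRingTower` that the signature lets depend
on `B_cris` is re-instantiated; the tower is built inside the proof — no `def`.) [folklore] -/
theorem exists_tower_beEqBplusLoc_and_beEqBcrisPhiOne :
    ∃ T : ATS3.PeriodRingTower (towerDatum p) p (Omega p),
      T.toBdR = toBdRAlg p ∧ T.t = X ∧ T.BdRplus = BdRplusΩ p ∧ T.frobB = (towerModel p).frobB ∧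
        T.Bcrisplus = (toBdRAlg p).range ∧ T.Bcris = (towerModel p).Bt ∧ T.BeEqBplusLoc ∧ T.BeEqBcrisPhiOne := by
  refine ⟨{ towerModel p with
    Bcrisplus := (toBdRAlg p).range
    Bcris := (towerModel p).Bt
    image_Bplus_subset_Bcrisplus := ?_
    Bcris_eq_adjoin := rfl
    frobCris := ((frobΩ p).comp (towerModel p).Bt.val).codRestrict (towerModel p).Bt fun x => frobΩ_mem_Bt p x.2
    frobCris_toBdR := ?_ }, rfl, rfl, rfl, rfl, rfl, rfl, towerModel_beEqBplusLoc p, ?_⟩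
  · rintro _ ⟨f, -, rfl⟩
    exact ⟨f, rfl⟩
  · intro x _ _
    exact frobΩ_toBdR p x
  · show (towerModel p).Be = {x | ∃ hx : x ∈ (towerModel p).Bt, frobΩ p x = x}
    ext x
    rw [towerModel_mem_Be_iff']
    constructor
    · rintro ⟨n, b, hb, hφ⟩
      have hx : x = toBdRAlg p b * (toBdRAlg p X)⁻¹ ^ n := by
        rw [hb, inv_pow, mul_comm, ← mul_assoc, inv_mul_cancel₀ (pow_ne_zero n (toBdRAlg_X_ne_zero p)), one_mul]
      rw [hx]
      exact ⟨toBdR_mul_inv_pow_mem_Bt p b n, (frobΩ_toBdR_mul_inv_pow_eq_iff p b n).2 hφ⟩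
    · rintro ⟨hx, hfix⟩
      obtain ⟨m, f, rfl⟩ := exists_eq_toBdR_mul_inv_pow p hx
      refine ⟨m, f, ?_, (frobΩ_toBdR_mul_inv_pow_eq_iff p f m).1 hfix⟩
      rw [mul_comm, mul_assoc, ← mul_pow, inv_mul_cancel₀ (toBdRAlg_X_ne_zero p), one_pow, mul_one]

/-- **INDEPENDENCE AND JOINT SATISFIABILITY of (5.2.6.1)'s outer descriptions over the typed §5 signature** (one datum,
one `B_dR`): `BeEqBcrisPhiOne` fails on one tower and holds, together with `BeEqBplusLoc`, on another. [folklore] -/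
theorem beEqBcrisPhiOne_independent :
    (∃ T : ATS3.PeriodRingTower (towerDatum p) p (Omega p), T.BeEqBplusLoc ∧ ¬ T.BeEqBcrisPhiOne) ∧
      ∃ T : ATS3.PeriodRingTower (towerDatum p) p (Omega p), T.BeEqBplusLoc ∧ T.BeEqBcrisPhiOne := by
  refine ⟨⟨towerModel p, towerModel_beEqBplusLoc p, towerModel_not_beEqBcrisPhiOne p⟩, ?_⟩
  obtain ⟨T, -, -, -, -, -, -, h1, h2⟩ := exists_tower_beEqBplusLoc_and_beEqBcrisPhiOne p
  exact ⟨T, h1, h2⟩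

end Summit.ABC.IUTFork.Joshi.Model

end
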